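import Summits.NavierStokesRegularity.NavierStokesRegularity.Theorems.PoloidalWindowRigidity.Negative.ExpTriadWave
import HarnessLib

/-!
# Three real exponential Kelvin modes with pairwise gradient interactions on a linear flow are
# EXACT Navier–Stokes solutions — part 2: time derivative, momentum equation, classical solution
# (negative-side tool for crux `PoloidalWindowRigidity`, K2, 19708)

Theorems/…/Negative proofs file (theorems only, no `Prop` facts), continuing `ExpTriadWave.lean`.

* `hasDerivWithinAt_triad_apply`, `triad_momentum`, `isDivFree_triad`, joint smoothness, and
  **`isClassicalNSSolutionOn_triad`**: for constant `A` with `div(A·) = 0`, `A²` symmetric, on a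
  time set `S` of unique differentiability: if `k̇_j = −A† k_j`, `ȧ_j = expAmplitudeRHS ν A k_j a_j`,
  `k_j ⊥ a_j`, `k_j ≠ 0`, and the PAIR CONDITION
  `⟪k_j, a_i⟫ a_j + ⟪k_i, a_j⟫ a_i = c_{ij} (k_i + k_j)` holds on `S` for the three pairs (with
  smooth `c_{ij}`), then `(triad, triadPressure)` is a classical Navier–Stokes solution with zero
  force and viscosity `ν` on `S × E`.  (The self-advection of each mode vanishes by transversality;
  the cross advection of modes `i ≠ j` is `e^{θ_i+θ_j}(⟪k_j,a_i⟫a_j + ⟪k_i,a_j⟫a_i)`, a gradient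
  exactly under the pair condition, absorbed by the pair terms of `triadPressure`.)

Spatially unbounded, infinite-energy exact solutions.  WHAT THIS IS NOT: not a statement about
Navier–Stokes regularity or blow-up; nothing here is in the route's class `𝔓(C)`; no registered
item is refuted by this file.  References as in `KelvinModeLinearFlow.lean` (mechanism only).
-/

noncomputable section

open Set Function Filter InnerProductSpace WithLp
open scoped ContDiff Laplacian InnerProductSpace RealInnerProductSpace InnerProduct Topology

-- the summit and its single sub-problem share the name (CONVENTIONS §1)
set_option linter.dupNamespace false

namespace Summit.NavierStokesRegularity.NavierStokesRegularity.Theorems.PoloidalWindowRigidity.Negative.ExpTriad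

open Literature.Analysis.FluidPDE Literature.Analysis.FluidPDE.KelvinMode

variable {E : Type*} [NormedAddCommGroup E] [InnerProductSpace ℝ E] [FiniteDimensional ℝ E]

/-! ### §4 The time derivative and the momentum equation -/

omit [FiniteDimensional ℝ E] in
/-- Time derivative of one exponential mode at a fixed point. [folklore] -/
private theorem hasDerivWithinAt_ewave_apply {S : Set ℝ} {t : ℝ} {k a : ℝ → E} {k' a' : E} (x : E)
    (hk : HasDerivWithinAt k k' S t) (ha : HasDerivWithinAt a a' S t) :
    HasDerivWithinAt (fun s => ewave (k s) (a s) x)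
      (Real.exp ⟪k t, x⟫ • a' + (Real.exp ⟪k t, x⟫ * ⟪k', x⟫) • a t) S t := by
  have hφ : HasDerivWithinAt (fun s => ⟪k s, x⟫) ⟪k', x⟫ S t := by
    simpa using hk.inner ℝ (hasDerivWithinAt_const t S x)
  have he : HasDerivWithinAt (fun s => Real.exp ⟪k s, x⟫) (Real.exp ⟪k t, x⟫ * ⟪k', x⟫) S t :=
    (Real.hasDerivAt_exp _).comp_hasDerivWithinAt t hφ
  exact he.smul ha

omit [FiniteDimensional ℝ E] in
/-- Time derivative of the triad flow at a fixed point `x` (within a time set `S`). [folklore] -/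
theorem hasDerivWithinAt_triad_apply (A : E →L[ℝ] E) {S : Set ℝ} {t : ℝ} {k a : Fin 3 → ℝ → E}
    {k' a' : Fin 3 → E} (x : E) (hk : ∀ j, HasDerivWithinAt (k j) (k' j) S t)
    (ha : ∀ j, HasDerivWithinAt (a j) (a' j) S t) :
    HasDerivWithinAt (fun s => triad A k a s x)
      ((Real.exp ⟪k 0 t, x⟫ • a' 0 + (Real.exp ⟪k 0 t, x⟫ * ⟪k' 0, x⟫) • a 0 t) +
        (Real.exp ⟪k 1 t, x⟫ • a' 1 + (Real.exp ⟪k 1 t, x⟫ * ⟪k' 1, x⟫) • a 1 t) +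
        (Real.exp ⟪k 2 t, x⟫ • a' 2 + (Real.exp ⟪k 2 t, x⟫ * ⟪k' 2, x⟫) • a 2 t)) S t :=
  (((hasDerivWithinAt_ewave_apply x (hk 0) (ha 0)).add
    (hasDerivWithinAt_ewave_apply x (hk 1) (ha 1))).add
    (hasDerivWithinAt_ewave_apply x (hk 2) (ha 2))).const_add (A x)

/-- **The momentum equation of the triad flow.** For `A²` symmetric, wavevectors `k̇_j = −A† k_j`,
amplitudes solving the exponential amplitude equation, transversal at time `t`, and the three
PAIR CONDITIONS `⟪k_j, a_i⟫ a_j + ⟪k_i, a_j⟫ a_i = c_{ij} (k_i + k_j)` at time `t`, at every `x`: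
`∂ₜu + (u·∇)u = νΔu − ∇p` with `u = triad A k a`, `p = triadPressure A k a c`. [folklore] -/
theorem triad_momentum {S : Set ℝ} (hS : UniqueDiffOn ℝ S) {ν : ℝ}
    {A : E →L[ℝ] E} (hA2 : ∀ x y : E, ⟪A (A x), y⟫ = ⟪x, A (A y)⟫) {k a : Fin 3 → ℝ → E}
    {c : Fin 3 → Fin 3 → ℝ → ℝ} {t : ℝ} (ht : t ∈ S)
    (hk : ∀ j, HasDerivWithinAt (k j) (-((A†) (k j t))) S t)
    (ha : ∀ j, HasDerivWithinAt (a j) (expAmplitudeRHS ν A (k j t) (a j t)) S t)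
    (hka : ∀ j, ⟪k j t, a j t⟫ = 0)
    (h01 : ⟪k 1 t, a 0 t⟫ • a 1 t + ⟪k 0 t, a 1 t⟫ • a 0 t = c 0 1 t • (k 0 t + k 1 t))
    (h02 : ⟪k 2 t, a 0 t⟫ • a 2 t + ⟪k 0 t, a 2 t⟫ • a 0 t = c 0 2 t • (k 0 t + k 2 t))
    (h12 : ⟪k 2 t, a 1 t⟫ • a 2 t + ⟪k 1 t, a 2 t⟫ • a 1 t = c 1 2 t • (k 1 t + k 2 t)) (x : E) :
    timeDerivWithin S (triad A k a) t x + convect (triad A k a t) (triad A k a t) x =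
      ν • Δ (triad A k a t) x - gradient (triadPressure A k a c t) x := by
  rw [timeDerivWithin_apply,
    (hasDerivWithinAt_triad_apply A x hk ha).derivWithin (hS t ht)]
  have hflow : triad A k a t =
      fun y => A y + (ewave (k 0 t) (a 0 t) y + ewave (k 1 t) (a 1 t) y + ewave (k 2 t) (a 2 t) y) :=
    rfl
  have hpress : triadPressure A k a c t = fun y => basePressure A y +
      (pressureCoeff A (k 0 t) (a 0 t) * Real.exp ⟪k 0 t, y⟫ +
        pressureCoeff A (k 1 t) (a 1 t) * Real.exp ⟪k 1 t, y⟫ +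
        pressureCoeff A (k 2 t) (a 2 t) * Real.exp ⟪k 2 t, y⟫) -
      (c 0 1 t * (Real.exp ⟪k 0 t, y⟫ * Real.exp ⟪k 1 t, y⟫) +
        c 0 2 t * (Real.exp ⟪k 0 t, y⟫ * Real.exp ⟪k 2 t, y⟫) +
        c 1 2 t * (Real.exp ⟪k 1 t, y⟫ * Real.exp ⟪k 2 t, y⟫)) := rfl
  rw [hflow, convect_slice, laplacian_slice, hpress, gradient_pressureSlice A _ _ _ hA2]
  have hkx : ∀ j, ⟪-((A†) (k j t)), x⟫ = -⟪k j t, A x⟫ := fun j => by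
    rw [inner_neg_left, ContinuousLinearMap.adjoint_inner_left]
  rw [hkx 0, hkx 1, hkx 2, hka 0, hka 1, hka 2]
  simp only [expAmplitudeRHS, pressureCoeff, ewave, mul_zero, add_zero, zero_add]
  linear_combination (norm := module)
    (Real.exp ⟪k 0 t, x⟫ * Real.exp ⟪k 1 t, x⟫) • h01 +
      (Real.exp ⟪k 0 t, x⟫ * Real.exp ⟪k 2 t, x⟫) • h02 +
      (Real.exp ⟪k 1 t, x⟫ * Real.exp ⟪k 2 t, x⟫) • h12

/-- **Incompressibility of the triad flow**: `div u(t) = 0` when `div(A·) = 0` and the amplitudes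
are transversal at time `t`. [folklore] -/
theorem isDivFree_triad {A : E →L[ℝ] E} (hdiv : VectorCalculus.IsDivFree (fun y => A y))
    {k a : Fin 3 → ℝ → E} {t : ℝ} (hka : ∀ j, ⟪k j t, a j t⟫ = 0) :
    VectorCalculus.IsDivFree (triad A k a t) := by
  intro x
  have hflow : triad A k a t =
      fun y => A y + (ewave (k 0 t) (a 0 t) y + ewave (k 1 t) (a 1 t) y + ewave (k 2 t) (a 2 t) y) :=
    rfl
  rw [hflow, divergence_slice, hdiv x, hka 0, hka 1, hka 2]
  ring

/-! ### §5 Smoothness and the classical-solution statement -/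

omit [FiniteDimensional ℝ E] in
/-- A smooth time-dependent vector, seen as a function on `S × E`, is smooth there. [folklore] -/
private theorem contDiffOn_comp_fst {F : Type*} [NormedAddCommGroup F] [NormedSpace ℝ F]
    {S : Set ℝ} {g : ℝ → F} (hg : ContDiffOn ℝ ∞ g S) :
    ContDiffOn ℝ ∞ (fun p : ℝ × E => g p.1) (S ×ˢ (univ : Set E)) :=
  hg.comp contDiff_fst.contDiffOn fun _ hp => (mem_prod.mp hp).1

omit [FiniteDimensional ℝ E] in
/-- The exponent `(t, x) ↦ e^{⟪k(t), x⟫}` is jointly smooth on `S × E`. [folklore] -/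
private theorem contDiffOn_exp_phase {S : Set ℝ} {k : ℝ → E} (hk : ContDiffOn ℝ ∞ k S) :
    ContDiffOn ℝ ∞ (fun p : ℝ × E => Real.exp ⟪k p.1, p.2⟫) (S ×ˢ (univ : Set E)) :=
  Real.contDiff_exp.comp_contDiffOn ((contDiffOn_comp_fst hk).inner ℝ contDiff_snd.contDiffOn)

omit [FiniteDimensional ℝ E] in
/-- One exponential mode `(t, x) ↦ e^{⟪k(t), x⟫} a(t)` is jointly smooth on `S × E`. [folklore] -/
private theorem contDiffOn_mode {S : Set ℝ} {k a : ℝ → E} (hk : ContDiffOn ℝ ∞ k S)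
    (ha : ContDiffOn ℝ ∞ a S) :
    ContDiffOn ℝ ∞ (fun p : ℝ × E => ewave (k p.1) (a p.1) p.2) (S ×ˢ (univ : Set E)) :=
  (contDiffOn_exp_phase hk).smul (contDiffOn_comp_fst ha)

omit [FiniteDimensional ℝ E] in
/-- **Joint smoothness of the triad flow** on `S × E`. [folklore] -/
theorem isSmoothSpaceTimeOn_triad (A : E →L[ℝ] E) {S : Set ℝ} {k a : Fin 3 → ℝ → E}
    (hk : ∀ j, ContDiffOn ℝ ∞ (k j) S) (ha : ∀ j, ContDiffOn ℝ ∞ (a j) S) :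
    IsSmoothSpaceTimeOn S (triad A k a) := by
  have hA : ContDiffOn ℝ ∞ (fun p : ℝ × E => A p.2) (S ×ˢ (univ : Set E)) :=
    (A.contDiff.comp contDiff_snd).contDiffOn
  show ContDiffOn ℝ ∞ (fun p : ℝ × E => A p.2 + (ewave (k 0 p.1) (a 0 p.1) p.2 +
    ewave (k 1 p.1) (a 1 p.1) p.2 + ewave (k 2 p.1) (a 2 p.1) p.2)) (S ×ˢ (univ : Set E))
  exact hA.add (((contDiffOn_mode (hk 0) (ha 0)).add (contDiffOn_mode (hk 1) (ha 1))).add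
    (contDiffOn_mode (hk 2) (ha 2)))

omit [FiniteDimensional ℝ E] in
/-- The pressure coefficient `−2⟪k, A a⟫/‖k‖²` is smooth in time where `k ≠ 0`. [folklore] -/
private theorem contDiffOn_pressureCoeff (A : E →L[ℝ] E) {S : Set ℝ} {k g : ℝ → E}
    (hk : ContDiffOn ℝ ∞ k S) (hg : ContDiffOn ℝ ∞ g S) (hk0 : ∀ t ∈ S, k t ≠ 0) :
    ContDiffOn ℝ ∞ (fun p : ℝ × E => pressureCoeff A (k p.1) (g p.1)) (S ×ˢ (univ : Set E)) := by
  have h1 : ContDiffOn ℝ ∞ (fun p : ℝ × E => ⟪k p.1, A (g p.1)⟫) (S ×ˢ (univ : Set E)) :=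
    (contDiffOn_comp_fst hk).inner ℝ (A.contDiff.comp_contDiffOn (contDiffOn_comp_fst hg))
  have h2 : ContDiffOn ℝ ∞ (fun p : ℝ × E => ‖k p.1‖ ^ 2) (S ×ˢ (univ : Set E)) :=
    (contDiffOn_comp_fst hk).norm_sq ℝ
  have h3 : ∀ p ∈ S ×ˢ (univ : Set E), ‖k p.1‖ ^ 2 ≠ 0 := fun p hp =>
    pow_ne_zero 2 (norm_ne_zero_iff.mpr (hk0 p.1 (mem_prod.mp hp).1))
  exact ((contDiffOn_const.mul h1).div h2 h3).neg

omit [FiniteDimensional ℝ E] in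
/-- **Joint smoothness of the triad pressure** on `S × E` (wavevectors non-vanishing, pair
coefficients smooth on `S`). [folklore] -/
theorem isSmoothSpaceTimeOn_triadPressure (A : E →L[ℝ] E) {S : Set ℝ} {k a : Fin 3 → ℝ → E}
    {c : Fin 3 → Fin 3 → ℝ → ℝ} (hk : ∀ j, ContDiffOn ℝ ∞ (k j) S)
    (ha : ∀ j, ContDiffOn ℝ ∞ (a j) S) (hc : ∀ i j, ContDiffOn ℝ ∞ (c i j) S)
    (hk0 : ∀ j, ∀ t ∈ S, k j t ≠ 0) : IsSmoothSpaceTimeOn S (triadPressure A k a c) := by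
  have he := fun j => contDiffOn_exp_phase (E := E) (hk j)
  have hπ := fun j => contDiffOn_pressureCoeff A (hk j) (ha j) (hk0 j)
  have hcc := fun i j => contDiffOn_comp_fst (E := E) (hc i j)
  have hbase : ContDiff ℝ ∞ (fun y : E => basePressure A y) :=
    contDiff_const.mul (contDiff_id.inner ℝ (A.comp A).contDiff)
  have hB : ContDiffOn ℝ ∞ (fun p : ℝ × E => basePressure A p.2) (S ×ˢ (univ : Set E)) :=
    (hbase.comp contDiff_snd).contDiffOn
  show ContDiffOn ℝ ∞ (fun p : ℝ × E => basePressure A p.2 +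
    (pressureCoeff A (k 0 p.1) (a 0 p.1) * Real.exp ⟪k 0 p.1, p.2⟫ +
      pressureCoeff A (k 1 p.1) (a 1 p.1) * Real.exp ⟪k 1 p.1, p.2⟫ +
      pressureCoeff A (k 2 p.1) (a 2 p.1) * Real.exp ⟪k 2 p.1, p.2⟫) -
    (c 0 1 p.1 * (Real.exp ⟪k 0 p.1, p.2⟫ * Real.exp ⟪k 1 p.1, p.2⟫) +
      c 0 2 p.1 * (Real.exp ⟪k 0 p.1, p.2⟫ * Real.exp ⟪k 2 p.1, p.2⟫) +
      c 1 2 p.1 * (Real.exp ⟪k 1 p.1, p.2⟫ * Real.exp ⟪k 2 p.1, p.2⟫))) (S ×ˢ (univ : Set E))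
  exact (hB.add ((((hπ 0).mul (he 0)).add ((hπ 1).mul (he 1))).add ((hπ 2).mul (he 2)))).sub
    ((((hcc 0 1).mul ((he 0).mul (he 1))).add ((hcc 0 2).mul ((he 0).mul (he 2)))).add
      ((hcc 1 2).mul ((he 1).mul (he 2))))

/-- **Three real exponential Kelvin modes with pairwise gradient interactions on a linear flow are
an exact classical Navier–Stokes solution.**  Let `A` be a constant continuous linear map with
`div (A·) = 0` and `A²` symmetric; on a time set `S` of unique differentiability let the three
wavevectors `k_j` and amplitudes `a_j` be smooth with `k̇_j = −A† k_j`,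
`ȧ_j = −A a_j + (2⟪k_j, A a_j⟫/‖k_j‖²) k_j + ν‖k_j‖² a_j`, `k_j ⊥ a_j`, `k_j ≠ 0` on `S`, and let the
pair conditions `⟪k_j, a_i⟫ a_j + ⟪k_i, a_j⟫ a_i = c_{ij} (k_i + k_j)` hold on `S` with smooth
`c_{ij}`.  Then `u(t, x) = A x + Σ_j e^{⟪k_j(t), x⟫} a_j(t)` with the pressure `triadPressure A k a c`
is a classical solution of the incompressible Navier–Stokes system with zero force and viscosity
`ν` on `S × E`.  Infinite-energy, spatially unbounded solutions. [folklore] -/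
theorem isClassicalNSSolutionOn_triad {S : Set ℝ} (hS : UniqueDiffOn ℝ S)
    {ν : ℝ} {A : E →L[ℝ] E} (hdiv : VectorCalculus.IsDivFree (fun y => A y))
    (hA2 : ∀ x y : E, ⟪A (A x), y⟫ = ⟪x, A (A y)⟫) {k a : Fin 3 → ℝ → E}
    {c : Fin 3 → Fin 3 → ℝ → ℝ}
    (hks : ∀ j, ContDiffOn ℝ ∞ (k j) S) (has : ∀ j, ContDiffOn ℝ ∞ (a j) S)
    (hcs : ∀ i j, ContDiffOn ℝ ∞ (c i j) S)
    (hk : ∀ j, ∀ t ∈ S, HasDerivWithinAt (k j) (-((A†) (k j t))) S t)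
    (ha : ∀ j, ∀ t ∈ S, HasDerivWithinAt (a j) (expAmplitudeRHS ν A (k j t) (a j t)) S t)
    (hka : ∀ j, ∀ t ∈ S, ⟪k j t, a j t⟫ = 0) (hk0 : ∀ j, ∀ t ∈ S, k j t ≠ 0)
    (h01 : ∀ t ∈ S, ⟪k 1 t, a 0 t⟫ • a 1 t + ⟪k 0 t, a 1 t⟫ • a 0 t = c 0 1 t • (k 0 t + k 1 t))
    (h02 : ∀ t ∈ S, ⟪k 2 t, a 0 t⟫ • a 2 t + ⟪k 0 t, a 2 t⟫ • a 0 t = c 0 2 t • (k 0 t + k 2 t))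
    (h12 : ∀ t ∈ S, ⟪k 2 t, a 1 t⟫ • a 2 t + ⟪k 1 t, a 2 t⟫ • a 1 t = c 1 2 t • (k 1 t + k 2 t)) :
    IsClassicalNSSolutionOn S ν 0 (triad A k a) (triadPressure A k a c) where
  smooth_velocity := isSmoothSpaceTimeOn_triad A hks has
  smooth_pressure := isSmoothSpaceTimeOn_triadPressure A hks has hcs hk0
  momentum t ht x := by
    rw [triad_momentum hS hA2 ht (fun j => hk j t ht) (fun j => ha j t ht) (fun j => hka j t ht)
      (h01 t ht) (h02 t ht) (h12 t ht) x]
    simp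
  divFree t ht := isDivFree_triad hdiv fun j => hka j t ht

end Summit.NavierStokesRegularity.NavierStokesRegularity.Theorems.PoloidalWindowRigidity.Negative.ExpTriad
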